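/-
Copyright: the b2b-balaban T⁴-continuum CRUX team, row NE7b, leaf lineage `t4-ne7b-formalise-leaf-02` (gen 130). Project licence.
-/
import Summits.QuantumFields.BalabanUV.T4Continuum.Spine.NE7b.ConvexWindowSuppliersLocal
import Summits.QuantumFields.BalabanUV.T4Continuum.Spine.NE7b.PlaquetteCubicBlockTable

/-!
# THE WINDOWED ROAD's BLOCK-SCHUR END FOR THE PLAQUETTE CUBIC, BY NAME AND BY VALUE: on T-61's per-bond window `L ∩ ⋂_b {‖Q_b y‖ ≤ a}`
# the first-order (convexity) letter for `⟪x, A x⟫ + g·P₃(x)` holds with modulus `2σ − 6·|g|·a` — `…ConvexWindowSuppliersLocal` §5's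
# END with EVERY structural hypothesis discharged, its `M` COMPUTED (`= 6|g|`, `…PlaquetteCubicBlockTable`) and `‖D²P(0)‖ = 0` PROVED
# (row NE7b, node U5c; letter (ℓ1) of the windowed road for ONE plaquette term at the flat background)

Cell `pub-balaban`, sub-cell `t4`, spine estimate NE7b (`T4WeightBudget.RelWeightBound`; the cell's OWN estimate — NOT PRINTED in
[Bałaban 1983–89], NOT PROVED).  Crux-route work under `Spine/NE7b/` by the row's E-side ∕ key-readings leaf lineage; NOTHING of
Bałaban's is named or asserted; no `T4Continuum/Support` leaf typed; no `def`, no notation; zero `sorry`.  Imports: this lineage's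
`…ConvexWindowSuppliersLocal` (p372269) and `…PlaquetteCubicBlockTable` (the block table `≤ 6|g|`).

WHY.  `…ConvexWindowSuppliersLocal.firstOrderOn_quadratic_add_of_blockFibreSums_blockWindow` displays, besides the three structural facts
about the block decomposition (`Σ_b Q_b = id`, Pythagoras, idempotence) and `P ∈ C³`, the two block fibre-sum letters `hrow ∕ hcol ≤ M` ON the
window and the number `‖D²P(0)‖`.  For the plaquette cubic `P = g·P₃` (`P₃(x) = det(x₀,x₁,x₂) + det(x₀,x₁,x₃) − det(x₀,x₂,x₃) − det(x₁,x₂,x₃)`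
in the bond blocks `x_b ∈ ℝ³`; identification with the Wilson action's cubic Taylor term = idea-1 T-71 ∕ refuter F463 (i), READ, not
re-derived) `…PlaquetteCubicBlockTable` supplies all of them with `M = 6|g|` at every point; THIS FILE adds `P ∈ C³`, `D²P(0) = 0` (the
diagonal of a trilinear form) and composes BY NAME.  Result: the road's letter (ℓ1) for this one term with displayed numbers `σ` (the
quadratic bottom), `g` (the coupling prefactor) and `a` (the per-bond radius) ONLY — the desk's «`λ = 2σ − h`, `h = c·ε`» shape with `c = 6`
per plaquette in the block-Schur currency (ρ-ne7bref-g74-1 ∕ g75-1), no `√n`, no block-dimension factor, no (A3) letter for this term.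

WHAT IS PROVED ([folklore]; `E = EuclideanSpace ℝ (Fin n)`, bond-block chart `e : Fin n ≃ Fin 4 × Fin 3`, block reader `β` ∕ block projections
`Q` characterised coordinatewise as in `…PlaquetteCubicBlockTable`):
* §1 `contDiff_diag` (`x ↦ f(x,x,x)` is `C³`), **`iteratedFDeriv_two_diag_zero`** (`D²(x ↦ f(x,x,x))(0) = 0`: Mathlib's
  `ContinuousMultilinearMap.norm_iteratedFDeriv_le` at `0` through the linear diagonal embedding).
* §2 **`firstOrderOn_quadratic_add_slotForm_blockWindow`**: for `f` any continuous trilinear form with values `g·𝔭(m)` (`𝔭` the cubic's slot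
  form), `A` symmetric `σ`-coercive, `L` a linear subspace, `a ≥ 0`:
  `∀ x y ∈ L ∩ ⋂_b {‖Q_b ·‖ ≤ a}, V x + ⟪∇V x, y − x⟫ + (2σ − 6|g|a)∕2·‖y − x‖² ≤ V y` for `V = ⟪·, A ·⟫ + f(·,·,·)`; and the `f`-free,
  reader-free form **`firstOrderOn_quadratic_add_plaquetteCubic`** with `V = ⟪·, A ·⟫ + g·P₃` written out in the chart (via
  `…PlaquetteCubicBlockTable.exists_slotForm`).

NOT HERE (honest): the quartic and higher Taylor terms and non-flat backgrounds (their block tables add to `M`); the sum over the plaquettes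
of a torus (`M ≤ 6ν|g|`, the cell count); WHICH `σ`, `g`, `a`, `L` are Bałaban's at step `k` and in which chart the window is a product of
per-bond balls ((A3) ∕ (A1c); refuter v101 §3 (i)–(ii), F515); anything of Bałaban's.  BY-NAME EFFECT ON THE WALL: NONE.  NE7b NOT PRINTED ∕
NOT PROVED; spine PROVED 0∕9; rung (B)+1 on a FINITE torus — NOT infinite volume, NOT the mass gap, NOT Clay.
HONEST DEPENDENCY: continuum YM on T⁴ ⇐ BetaPertH ∧ nine spine estimates (0/9 proved); BetaPertH ⇐ (D1) ∧ (D4) ∧ CAP+tail.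
-/

set_option autoImplicit false

noncomputable section

open Real InnerProductSpace Set Finset Equiv
open scoped RealInnerProductSpace Matrix Gradient
open Summit.QuantumFields.BalabanUV.T4Continuum.NE7b.ConvexWindowSuppliersLocal
open Summit.QuantumFields.BalabanUV.T4Continuum.NE7b.PlaquetteCubicBlockTable

namespace Summit.QuantumFields.BalabanUV.T4Continuum.NE7b.PlaquetteCubicWindow

variable {n : ℕ}

/-! ## §1 The diagonal of a trilinear form: smoothness and the vanishing of the second derivative at the flat point -/

/-- `P = (x ↦ f(x,x,x))` is `C³`. [folklore] -/
theorem contDiff_diag (f : ContinuousMultilinearMap ℝ (fun _ : Fin 3 => EuclideanSpace ℝ (Fin n)) ℝ) :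
    ContDiff ℝ 3 (fun x : EuclideanSpace ℝ (Fin n) => f (fun _ => x)) :=
  f.contDiff.comp (contDiff_pi.2 fun _ => contDiff_id)

/-- **`D²P(0) = 0`** for the diagonal `P` of a trilinear form (Mathlib's `ContinuousMultilinearMap.norm_iteratedFDeriv_le` at `x = 0`:
`‖D²f(x)‖ ≤ 3·2·‖f‖·‖x‖`, composed with the linear diagonal embedding). [folklore] -/
theorem iteratedFDeriv_two_diag_zero (f : ContinuousMultilinearMap ℝ (fun _ : Fin 3 => EuclideanSpace ℝ (Fin n)) ℝ) :
    iteratedFDeriv ℝ 2 (fun x : EuclideanSpace ℝ (Fin n) => f (fun _ => x)) 0 = 0 := by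
  let ι : EuclideanSpace ℝ (Fin n) →L[ℝ] (Fin 3 → EuclideanSpace ℝ (Fin n)) :=
    ContinuousLinearMap.pi fun _ => ContinuousLinearMap.id ℝ _
  have hcomp : (fun x : EuclideanSpace ℝ (Fin n) => f (fun _ => x)) = ⇑f ∘ ⇑ι := rfl
  rw [hcomp, ContinuousLinearMap.iteratedFDeriv_comp_right ι f.contDiff 0 le_rfl, map_zero]
  have h0 : iteratedFDeriv ℝ 2 (⇑f) 0 = 0 := by
    have h := f.norm_iteratedFDeriv_le 2 (0 : Fin 3 → EuclideanSpace ℝ (Fin n))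
    simp only [Fintype.card_fin, norm_zero] at h
    norm_num at h
    simpa using h
  rw [h0]; rfl

/-! ## §2 The END on T-61's per-bond window BY NAME: `…ConvexWindowSuppliersLocal` §5 with every hypothesis discharged and `M = 6|g|` -/

section End

variable (e : Fin n ≃ Fin 4 × Fin 3) (β : EuclideanSpace ℝ (Fin n) → Fin 4 → Fin 3 → ℝ)
  (Q : Fin 4 → EuclideanSpace ℝ (Fin n) →L[ℝ] EuclideanSpace ℝ (Fin n))

/-- **THE END FOR `⟪x, A x⟫ + f(x,x,x)`, `f` THE CUBIC's SLOT FORM TIMES `g`** (`…ConvexWindowSuppliersLocal.firstOrderOn_quadratic_add_of_blockFibreSums_blockWindow`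
with `hQ ∕ hQ2 ∕ hidem` from `…PlaquetteCubicBlockTable` §2, `hP` = `contDiff_diag`, `hrow ∕ hcol` = the block table at `s = 1 ∕ 2`, `M = 6|g|`, and
`‖D²P(0)‖ = 0`): on `K = L ∩ ⋂_b {‖Q_b y‖ ≤ a}` (per-bond radius `a ≥ 0`, `L` a linear subspace), for `A` symmetric `σ`-coercive, the
first-order letter holds ON `K` with modulus `2σ − 6·|g|·a`. [folklore] -/
theorem firstOrderOn_quadratic_add_slotForm_blockWindow (hβ : ∀ v b i, β v b i = v (e.symm (b, i)))
    (hQ : ∀ b x j, Q b x j = if (e j).1 = b then x j else 0)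
    (f : ContinuousMultilinearMap ℝ (fun _ : Fin 3 => EuclideanSpace ℝ (Fin n)) ℝ) (g : ℝ)
    (hf : ∀ m, f m = g * (β (m 0) 0 ⬝ᵥ β (m 1) 1 ⨯₃ β (m 2) 2 + β (m 0) 0 ⬝ᵥ β (m 1) 1 ⨯₃ β (m 2) 3
      - β (m 0) 0 ⬝ᵥ β (m 1) 2 ⨯₃ β (m 2) 3 - β (m 0) 1 ⬝ᵥ β (m 1) 2 ⨯₃ β (m 2) 3))
    (A : EuclideanSpace ℝ (Fin n) →L[ℝ] EuclideanSpace ℝ (Fin n)) (L : Submodule ℝ (EuclideanSpace ℝ (Fin n))) {a σ : ℝ} (ha : 0 ≤ a)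
    (hA : ∀ v w : EuclideanSpace ℝ (Fin n), ⟪A v, w⟫ = ⟪v, A w⟫) (hσ : ∀ v : EuclideanSpace ℝ (Fin n), σ * ‖v‖ ^ 2 ≤ ⟪v, A v⟫) :
    ∀ x ∈ (L : Set (EuclideanSpace ℝ (Fin n))) ∩ {y | ∀ b, ‖Q b y‖ ≤ a},
      ∀ y ∈ (L : Set (EuclideanSpace ℝ (Fin n))) ∩ {y | ∀ b, ‖Q b y‖ ≤ a},
        (⟪x, A x⟫ + f (fun _ => x)) + ⟪gradient (fun z : EuclideanSpace ℝ (Fin n) => ⟪z, A z⟫ + f (fun _ => z)) x, y - x⟫ +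
          (2 * σ - 6 * |g| * a) / 2 * ‖y - x‖ ^ 2 ≤ ⟪y, A y⟫ + f (fun _ => y) := by
  have h := firstOrderOn_quadratic_add_of_blockFibreSums_blockWindow A Q (proj_sum e Q hQ) (proj_pythagoras e Q hQ)
    (proj_idem e Q hQ) L ha hA hσ (contDiff_diag f) (by positivity : (0 : ℝ) ≤ 6 * |g|)
    (fun z _ b => blockFibreSum_thirdDeriv_le e β Q hβ hQ f g hf z 1 b)
    (fun z _ b => blockFibreSum_thirdDeriv_le e β Q hβ hQ f g hf z 2 b)
  rw [iteratedFDeriv_two_diag_zero, norm_zero, zero_add] at h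
  exact h

/-- **THE END, `f`-FREE AND READER-FREE: THE CONVEXITY LETTER FOR `⟪x, A x⟫ + g·P₃(x)` ON THE PER-BOND WINDOW WITH MODULUS `2σ − 6|g|a`.**
`P₃(x) = det(x₀,x₁,x₂) + det(x₀,x₁,x₃) − det(x₀,x₂,x₃) − det(x₁,x₂,x₃)` written out in the chart `e` (`x_b = (i ↦ x (e.symm (b, i)))`,
`det` the triple product); `Q` the bond-block projections (characterised coordinatewise — they exist, `…PlaquetteCubicBlockTable.exists_proj`);
`K = L ∩ ⋂_b {‖Q_b y‖ ≤ a}`; `A` symmetric `σ`-coercive.  The displayed numbers are `σ`, `g`, `a` ONLY. [folklore] -/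
theorem firstOrderOn_quadratic_add_plaquetteCubic (hQ : ∀ b x j, Q b x j = if (e j).1 = b then x j else 0) (g : ℝ)
    (A : EuclideanSpace ℝ (Fin n) →L[ℝ] EuclideanSpace ℝ (Fin n)) (L : Submodule ℝ (EuclideanSpace ℝ (Fin n))) {a σ : ℝ} (ha : 0 ≤ a)
    (hA : ∀ v w : EuclideanSpace ℝ (Fin n), ⟪A v, w⟫ = ⟪v, A w⟫) (hσ : ∀ v : EuclideanSpace ℝ (Fin n), σ * ‖v‖ ^ 2 ≤ ⟪v, A v⟫) :
    ∀ x ∈ (L : Set (EuclideanSpace ℝ (Fin n))) ∩ {y | ∀ b, ‖Q b y‖ ≤ a},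
      ∀ y ∈ (L : Set (EuclideanSpace ℝ (Fin n))) ∩ {y | ∀ b, ‖Q b y‖ ≤ a},
        (⟪x, A x⟫ + g * ((fun i : Fin 3 => x (e.symm (0, i))) ⬝ᵥ (fun i => x (e.symm (1, i))) ⨯₃ (fun i => x (e.symm (2, i)))
            + (fun i : Fin 3 => x (e.symm (0, i))) ⬝ᵥ (fun i => x (e.symm (1, i))) ⨯₃ (fun i => x (e.symm (3, i)))
            - (fun i : Fin 3 => x (e.symm (0, i))) ⬝ᵥ (fun i => x (e.symm (2, i))) ⨯₃ (fun i => x (e.symm (3, i)))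
            - (fun i : Fin 3 => x (e.symm (1, i))) ⬝ᵥ (fun i => x (e.symm (2, i))) ⨯₃ (fun i => x (e.symm (3, i)))))
        + ⟪gradient (fun z : EuclideanSpace ℝ (Fin n) => ⟪z, A z⟫
            + g * ((fun i : Fin 3 => z (e.symm (0, i))) ⬝ᵥ (fun i => z (e.symm (1, i))) ⨯₃ (fun i => z (e.symm (2, i)))
              + (fun i : Fin 3 => z (e.symm (0, i))) ⬝ᵥ (fun i => z (e.symm (1, i))) ⨯₃ (fun i => z (e.symm (3, i)))
              - (fun i : Fin 3 => z (e.symm (0, i))) ⬝ᵥ (fun i => z (e.symm (2, i))) ⨯₃ (fun i => z (e.symm (3, i)))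
              - (fun i : Fin 3 => z (e.symm (1, i))) ⬝ᵥ (fun i => z (e.symm (2, i))) ⨯₃ (fun i => z (e.symm (3, i))))) x, y - x⟫
        + (2 * σ - 6 * |g| * a) / 2 * ‖y - x‖ ^ 2
        ≤ ⟪y, A y⟫ + g * ((fun i : Fin 3 => y (e.symm (0, i))) ⬝ᵥ (fun i => y (e.symm (1, i))) ⨯₃ (fun i => y (e.symm (2, i)))
            + (fun i : Fin 3 => y (e.symm (0, i))) ⬝ᵥ (fun i => y (e.symm (1, i))) ⨯₃ (fun i => y (e.symm (3, i)))
            - (fun i : Fin 3 => y (e.symm (0, i))) ⬝ᵥ (fun i => y (e.symm (2, i))) ⨯₃ (fun i => y (e.symm (3, i)))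
            - (fun i : Fin 3 => y (e.symm (1, i))) ⬝ᵥ (fun i => y (e.symm (2, i))) ⨯₃ (fun i => y (e.symm (3, i)))) := by
  obtain ⟨f, hf⟩ := exists_slotForm e (fun v b i => v (e.symm (b, i))) (fun _ _ _ => rfl) g
  intro x hx y hy
  have h := firstOrderOn_quadratic_add_slotForm_blockWindow e (fun v b i => v (e.symm (b, i))) Q (fun _ _ _ => rfl) hQ f g hf
    A L ha hA hσ x hx y hy
  simp only [hf] at h
  exact h

end End

end Summit.QuantumFields.BalabanUV.T4Continuum.NE7b.PlaquetteCubicWindow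

end
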